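import Literature.Analysis.FluidPDE.SpaceTimeMollifier
import Literature.Analysis.FluidPDE.MollifiedLimits
import Literature.Analysis.FluidPDE.SobolevWholeSpace
import Literature.Analysis.FluidPDE.SuitableWeak
import Literature.Analysis.FluidPDE.TaoEnstrophyLocalisationProofs
import HarnessLib

/-!
# Interior `L⁴` integrability of `L_{3,∞} ∩ L₂W¹₂` fields on the unit cylinder

Analysis/FluidPDE support file (serves the discharge of `NS.ess_suitable_of_L3infty'`). It proves
the sentence "the fact `v ∈ L₄(Q)` […] is just a consequence of the known multiplicative
inequality" of Escauriaza–Seregin–Šverák 2003, proof of Thm. 1.4, in the interior form needed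
for the mollification argument: if `v` on `Q = (-1, 0) × B(0, 1)` (`dim E = 3`) has a sliced
`L³` bound, `𝟙_Q v ∈ L²` and a weak spatial gradient with `𝟙_Q ∇v ∈ L²`, then
`∫∫_{(-1+τ,-τ) × B(0,ρ)} |v|⁴ < ∞` for all `0 < ρ < 1`, `0 < τ`
(`lintegral_pow_four_interior_lt_top`). Proof: mollify in space–time (`D Vₙ = kₙ ⋆ 𝟙_Q ∇v` in
the interior, `FluidPDE/SpaceTimeMollifier`), cut off in space, apply the
Gagliardo–Nirenberg–Sobolev inequality `‖·‖₆ ≤ K ‖D·‖₂` slice-wise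
(`FluidPDE/SobolevWholeSpace`), interpolate `‖·‖₄⁴ ≤ ‖·‖₃² ‖·‖₆²` with the sliced `L³` bound
(which survives mollification, `FluidPDE/MollifiedLimits`), integrate in time with Young's
inequality, and conclude by Fatou along an a.e.-convergent subsequence. All proved; no new
definitions.

## Mathlib search

Mathlib has the GNS inequality for compactly supported `C¹` maps
(`MeasureTheory.eLpNorm_le_eLpNorm_fderiv_of_eq`), Young's inequality through the tree
(`Literature.Analysis.FunctionSpaces.eLpNorm_normed_convolution_le_haar`), Fatou (`lintegral_liminf_le'`) and
`L^p`-convergence of mollification through the tree (`Literature.Analysis.FunctionSpaces.tendsto_eLpNorm_normed_convolution_sub_self`);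
no Navier–Stokes or cylinder notions.

## References

* L. Escauriaza, G. Seregin, V. Šverák, *`L_{3,∞}`-solutions of Navier–Stokes equations and
  backward uniqueness*, Russ. Math. Surveys 58:2 (2003), §3, proof of Thm. 1.4, first paragraph,
  and (3.7) (the multiplicative inequality).
* L. C. Evans, *Partial Differential Equations*, 2nd ed. (2010), §5.6.1, Thm. 1.
-/

noncomputable section

open MeasureTheory TopologicalSpace Set Function Filter Topology ContinuousLinearMap Metric
  InnerProductSpace Module
open scoped ENNReal NNReal Convolution RealInnerProductSpace

namespace Literature.Analysis.FluidPDE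

section L4

variable {E : Type*} [NormedAddCommGroup E] [InnerProductSpace ℝ E] [FiniteDimensional ℝ E]
  [MeasurableSpace E] [BorelSpace E]
variable {F : Type*} [NormedAddCommGroup F] [NormedSpace ℝ F]

/-! #### The unit cylinder and interior balls -/

omit [MeasurableSpace E] [BorelSpace E] [FiniteDimensional ℝ E] [InnerProductSpace ℝ E] in
/-- The unit backward parabolic cylinder is `(-1, 0) × B(0, 1)`. [folklore] -/
theorem parabolicCylinder_one_zero :
    parabolicCylinder 1 ((0 : ℝ), (0 : E)) = Ioo (-1 : ℝ) 0 ×ˢ ball (0 : E) 1 := by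
  simp [parabolicCylinder]

omit [MeasurableSpace E] [BorelSpace E] [FiniteDimensional ℝ E] [InnerProductSpace ℝ E] in
/-- **Interior balls of the unit cylinder** (sup metric on `ℝ × E`): if `-1 < s - r`, `s + r < 0`
and `‖y‖ + r < 1` then `closedBall (s, y) r ⊆ (-1, 0) × B(0, 1)`. [folklore] -/
theorem closedBall_subset_unitCylinder [NormedSpace ℝ E] {s r : ℝ} {y : E} (h1 : -1 < s - r)
    (h2 : s + r < 0) (h3 : ‖y‖ + r < 1) :
    closedBall ((s, y) : ℝ × E) r ⊆ Ioo (-1 : ℝ) 0 ×ˢ ball (0 : E) 1 := by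
  intro w hw
  rw [mem_closedBall, Prod.dist_eq, max_le_iff, Real.dist_eq, dist_eq_norm] at hw
  refine ⟨⟨?_, ?_⟩, ?_⟩
  · linarith [(abs_le.1 hw.1).1]
  · linarith [(abs_le.1 hw.1).2]
  · rw [mem_ball, dist_zero_right]
    calc ‖w.2‖ = ‖(w.2 - y) + y‖ := by rw [sub_add_cancel]
      _ ≤ ‖w.2 - y‖ + ‖y‖ := norm_add_le _ _
      _ < 1 := by linarith [hw.2]

/-! #### Small tools -/

omit [MeasurableSpace E] [BorelSpace E] [FiniteDimensional ℝ E] [InnerProductSpace ℝ E] in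
/-- Scalar convolutions only see the function up to a.e. equality. [folklore] -/
theorem convolution_lsmul_congr_ae {G : Type*} [NormedAddCommGroup G] [NormedSpace ℝ G]
    [MeasurableSpace G] [BorelSpace G] [FiniteDimensional ℝ G] {μ : Measure G}
    [μ.IsAddHaarMeasure] {k : G → ℝ} {f g : G → F} (h : f =ᵐ[μ] g) (x : G) :
    (k ⋆[lsmul ℝ ℝ, μ] f) x = (k ⋆[lsmul ℝ ℝ, μ] g) x := by
  simp only [convolution_def, lsmul_apply]
  refine integral_congr_ae ?_
  have h' : (fun t => f (x - t)) =ᵐ[μ] fun t => g (x - t) :=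
    (Measure.measurePreserving_sub_left μ x).quasiMeasurePreserving.ae_eq h
  filter_upwards [h'] with t ht
  rw [ht]

omit [MeasurableSpace E] [BorelSpace E] [FiniteDimensional ℝ E] [InnerProductSpace ℝ E]
  [NormedAddCommGroup E] in
/-- `(a + b)² ≤ 2a² + 2b²` for `enorm`s: if `‖x‖ ≤ a + c * b` then
`‖x‖ₑ² ≤ 2 (ofReal a² + ofReal c² * ofReal b²)`. [folklore] -/
theorem enorm_sq_le_two_mul {X : Type*} [NormedAddCommGroup X] {x : X} {a b c : ℝ}
    (h : ‖x‖ ≤ a + c * b) :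
    ‖x‖ₑ ^ 2 ≤ 2 * (ENNReal.ofReal (a ^ 2) + ENNReal.ofReal (c ^ 2) * ENNReal.ofReal (b ^ 2)) := by
  have h1 : ‖x‖ ^ 2 ≤ 2 * (a ^ 2 + c ^ 2 * b ^ 2) := by
    have h0 : 0 ≤ a + c * b := (norm_nonneg _).trans h
    have : ‖x‖ ^ 2 ≤ (a + c * b) ^ 2 := by gcongr
    nlinarith [sq_nonneg (a - c * b)]
  rw [← ofReal_norm, ← ENNReal.ofReal_pow (norm_nonneg _)]
  refine (ENNReal.ofReal_le_ofReal h1).trans (le_of_eq ?_)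
  rw [ENNReal.ofReal_mul (by norm_num), ENNReal.ofReal_ofNat, ENNReal.ofReal_add (by positivity)
    (by positivity), ENNReal.ofReal_mul (by positivity)]

omit [NormedSpace ℝ F] in
/-- `‖f‖_{L⁶}² = (∫⁻ ‖f‖ₑ⁶)^{1/3}`. [folklore] -/
theorem eLpNorm_six_pow_two {X : Type*} [MeasurableSpace X] {μ : Measure X} (f : X → F) :
    eLpNorm f 6 μ ^ 2 = (∫⁻ x, ‖f x‖ₑ ^ (6 : ℝ) ∂μ) ^ (1 / 3 : ℝ) := by
  rw [eLpNorm_eq_lintegral_rpow_enorm_toReal (by norm_num) (by norm_num)]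
  have h6 : (6 : ℝ≥0∞).toReal = 6 := by norm_num
  rw [h6, ← ENNReal.rpow_natCast, ← ENNReal.rpow_mul]
  norm_num

omit [NormedSpace ℝ F] in
/-- The interpolation `∫ |w|⁴ ≤ (∫ |w|³)^{2/3} (∫ |w|⁶)^{1/3}` (Hölder with exponents `3/2` and
`3` applied to `|w|² · |w|²`; Escauriaza–Seregin–Šverák 2003, §3 "known multiplicative
inequality"). [folklore] -/
theorem lintegral_pow_four_le_interpolation {X : Type*} [MeasurableSpace X] (μ : Measure X)
    {w : X → F} (hw : AEStronglyMeasurable w μ) :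
    ∫⁻ x, ‖w x‖ₑ ^ 4 ∂μ ≤
      (∫⁻ x, ‖w x‖ₑ ^ (3 : ℝ) ∂μ) ^ (2 / 3 : ℝ) * (∫⁻ x, ‖w x‖ₑ ^ (6 : ℝ) ∂μ) ^ (1 / 3 : ℝ) := by
  have hpq : Real.HolderConjugate (3 / 2) 3 := by
    rw [Real.holderConjugate_iff]; norm_num
  have hm : AEMeasurable (fun x => ‖w x‖ₑ ^ 2) μ := hw.enorm.pow_const 2
  have h := ENNReal.lintegral_mul_le_Lp_mul_Lq μ hpq hm hm
  have e1 : ∀ x, ‖w x‖ₑ ^ 2 * ‖w x‖ₑ ^ 2 = ‖w x‖ₑ ^ 4 := fun x => by rw [← pow_add]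
  have e2 : ∀ x, (‖w x‖ₑ ^ 2) ^ (3 / 2 : ℝ) = ‖w x‖ₑ ^ (3 : ℝ) := fun x => by
    rw [← ENNReal.rpow_natCast, ← ENNReal.rpow_mul]; norm_num
  have e3 : ∀ x, (‖w x‖ₑ ^ 2) ^ (3 : ℝ) = ‖w x‖ₑ ^ (6 : ℝ) := fun x => by
    rw [← ENNReal.rpow_natCast, ← ENNReal.rpow_mul]; norm_num
  simp only [Pi.mul_apply, e1, e2, e3] at h
  have e4 : (1 / (3 / 2) : ℝ) = 2 / 3 := by norm_num
  rw [e4] at h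
  exact h

/-! #### The interior `L⁴` bound -/

/-- **Interior `L⁴` integrability of `L_{3,∞} ∩ L₂W¹₂` fields** (Escauriaza–Seregin–Šverák 2003,
proof of Thm. 1.4, first paragraph: "`v ∈ L₄(Q)` […] is just a consequence of the known
multiplicative inequality"). Let `dim E = 3` and `Q = (-1, 0) × B(0, 1)`. Let `v` be integrable on
`Q` with zero extension `ṽ = 𝟙_Q v ∈ L²(ℝ × E)`, sliced bound `∫ ‖ṽ(s, y)‖³ dy ≤ C₃ < ∞` for
a.e. `s`, and a weak spatial gradient `G` on `Q` with `G` integrable on `Q` and `𝟙_Q G ∈ L²`. Then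
`∫∫_{(-1+τ, -τ) × B(0, ρ)} ‖ṽ‖⁴ < ∞` for all `0 < ρ < 1`, `0 < τ`. Proof: mollify in space–time
(`Vₙ = kₙ ⋆ ṽ`, so `D Vₙ = kₙ ⋆ 𝟙_Q G` in the interior), cut off in space by `ζ`, apply the
Gagliardo–Nirenberg–Sobolev inequality `‖ζVₙ(s)‖₆ ≤ K ‖D(ζVₙ(s))‖₂` slice-wise, interpolate
`‖·‖₄⁴ ≤ ‖·‖₃² ‖·‖₆²` with the sliced `L³` bound (which survives mollification, Jensen), integrate
in time using Young's inequality, and conclude by Fatou along an a.e.-convergent subsequence. [cite: EscauriazaSereginSverak2003, §3, proof of Thm. 1.4, first paragraph] -/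
theorem lintegral_pow_four_interior_lt_top (hE : finrank ℝ E = 3)
    {v : ℝ → E → E} {G : ℝ → E → E →L[ℝ] E}
    (hu : IntegrableOn (uncurry v) (Ioo (-1 : ℝ) 0 ×ˢ ball (0 : E) 1) volume)
    (hu2 : MemLp (zeroExt (parabolicCylinderOpens 1 ((0 : ℝ), (0 : E))) v) 2 volume)
    {C₃ : ℝ≥0∞} (hC₃ : C₃ < ∞)
    (h3 : ∀ᵐ s : ℝ, ∫⁻ y, ‖zeroExt (parabolicCylinderOpens 1 ((0 : ℝ), (0 : E))) v (s, y)‖ₑ ^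
      (3 : ℝ) ≤ C₃)
    (hG : HasWeakSpatialGradientOn (parabolicCylinderOpens 1 ((0 : ℝ), (0 : E))) v G)
    (hGi : IntegrableOn (uncurry G) (Ioo (-1 : ℝ) 0 ×ˢ ball (0 : E) 1) volume)
    (hG2 : MemLp (zeroExt (parabolicCylinderOpens 1 ((0 : ℝ), (0 : E))) G) 2 volume)
    {ρ τ : ℝ} (hρ : 0 < ρ) (hρ1 : ρ < 1) (hτ : 0 < τ) :
    ∫⁻ z in Ioo (-1 + τ) (-τ) ×ˢ ball (0 : E) ρ,
      ‖zeroExt (parabolicCylinderOpens 1 ((0 : ℝ), (0 : E))) v z‖ₑ ^ 4 < ∞ := by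
  haveI : (volume : Measure (ℝ × E)).IsAddHaarMeasure := Measure.prod.instIsAddHaarMeasure _ _
  set Qo : Opens (ℝ × E) := parabolicCylinderOpens 1 ((0 : ℝ), (0 : E)) with hQo
  have hQ : (Qo : Set (ℝ × E)) = Ioo (-1 : ℝ) 0 ×ˢ ball (0 : E) 1 := by
    rw [hQo, coe_parabolicCylinderOpens, parabolicCylinder_one_zero]
  set ũ : ℝ × E → E := zeroExt Qo v with hũ
  set Gt : ℝ × E → E →L[ℝ] E := zeroExt Qo G with hGt
  set I : Set ℝ := Ioo (-1 + τ) (-τ) with hI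
  -- integrability of the zero extensions
  have hu' : IntegrableOn (uncurry v) (Qo : Set (ℝ × E)) volume := by rwa [hQ]
  have hGi' : IntegrableOn (uncurry G) (Qo : Set (ℝ × E)) volume := by rwa [hQ]
  have hũi : LocallyIntegrable ũ volume := locallyIntegrable_zeroExt hu'
  have hGti : LocallyIntegrable Gt volume := locallyIntegrable_zeroExt hGi'
  -- a strongly measurable representative of `ũ` carrying the sliced `L³` bound
  set ũ' : ℝ × E → E := hu2.1.mk ũ with hũ'
  have hũ'm : StronglyMeasurable ũ' := hu2.1.stronglyMeasurable_mk
  have hũũ' : ũ =ᵐ[volume] ũ' := hu2.1.ae_eq_mk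
  have h3' : ∀ᵐ s : ℝ, ∫⁻ y, ‖ũ' (s, y)‖ₑ ^ (3 : ℝ) ≤ C₃ := by
    have h1 : ∀ᵐ s : ℝ, ∀ᵐ y : E, ũ (s, y) = ũ' (s, y) := by
      have := hũũ'
      rw [Measure.volume_eq_prod] at this
      exact Measure.ae_ae_eq_curry_of_prod this
    filter_upwards [h3, h1] with s hs hs'
    have e : ∀ᵐ y : E, ‖ũ (s, y)‖ₑ ^ (3 : ℝ) = ‖ũ' (s, y)‖ₑ ^ (3 : ℝ) :=
      hs'.mono fun y hy => by rw [hy]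
    rw [← lintegral_congr_ae e]
    exact hs
  -- the mollifier sequence
  obtain ⟨φ, hφr, -⟩ := FunctionSpaces.exists_contDiffBump_seq (E := ℝ × E)
  set k : ℕ → ℝ × E → ℝ := fun n => (φ n).normed volume with hk
  have hkinf : ∀ n, ContDiff ℝ (⊤ : ℕ∞) (k n) := fun n => (φ n).contDiff_normed
  have hkr : ∀ n w, w ∉ closedBall (0 : ℝ × E) (φ n).rOut → k n w = 0 := fun n w hw => by
    have : w ∉ Function.support (k n) := by
      rw [hk, (φ n).support_normed_eq]; exact fun h => hw (ball_subset_closedBall h)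
    simpa using this
  have hkc : ∀ n, HasCompactSupport (k n) := fun n => (φ n).hasCompactSupport_normed
  have hk0 : ∀ n w, 0 ≤ k n w := fun n w => (φ n).nonneg_normed w
  have hk1 : ∀ n, ∫ w, k n w = 1 := fun n => (φ n).integral_normed
  set V : ℕ → ℝ → E → E := fun n => stMollify (k n) ũ with hV
  set Gm : ℕ → ℝ → E → (E →L[ℝ] E) := fun n => stMollify (k n) Gt with hGm
  have hVs : ∀ n s, ContDiff ℝ (⊤ : ℕ∞) (V n s) := fun n s => contDiff_stMollify_slice (hkinf n) (hkc n) hũi s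
  have hVc : ∀ n, Continuous (uncurry (V n)) := fun n =>
    (contDiff_uncurry_stMollify (hkinf n) (hkc n) hũi).continuous
  have hGmc : ∀ n, Continuous (uncurry (Gm n)) := fun n =>
    (contDiff_uncurry_stMollify (hkinf n) (hkc n) hGti).continuous
  -- the spatial cut-off
  set ρ₁ : ℝ := (ρ + 1) / 2 with hρ₁
  have hρρ₁ : ρ < ρ₁ := by rw [hρ₁]; linarith
  have hρ₁1 : ρ₁ < 1 := by rw [hρ₁]; linarith
  let ζ : ContDiffBump (0 : E) := ⟨ρ, ρ₁, hρ, hρρ₁⟩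
  have hζ1 : ContDiff ℝ 1 ζ := ζ.contDiff
  obtain ⟨Cζ, hCζ⟩ := (hζ1.continuous_fderiv one_ne_zero).bounded_above_of_compact_support
    (ζ.hasCompactSupport.fderiv ℝ)
  have hCζ0 : 0 ≤ Cζ := (norm_nonneg _).trans (hCζ 0)
  have hζsupp : ∀ y : E, ρ₁ < ‖y‖ → ζ y = 0 ∧ fderiv ℝ (ζ : E → ℝ) y = 0 := fun y hy => by
    have hy' : y ∉ tsupport (ζ : E → ℝ) := by
      rw [ζ.tsupport_eq, mem_closedBall, dist_zero_right]; exact not_le.2 hy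
    exact ⟨image_eq_zero_of_notMem_tsupport hy', fderiv_of_notMem_tsupport ℝ hy'⟩
  -- the margin
  set δ₀ : ℝ := min τ (1 - ρ₁) / 2 with hδ₀
  have hδ₀pos : 0 < δ₀ := by
    rw [hδ₀]; exact div_pos (lt_min hτ (by linarith)) two_pos
  have hδτ : δ₀ < τ := by
    rw [hδ₀]; linarith [min_le_left τ (1 - ρ₁), lt_min hτ (by linarith : (0:ℝ) < 1 - ρ₁)]
  have hδρ : ρ₁ + δ₀ < 1 := by
    rw [hδ₀]; linarith [min_le_right τ (1 - ρ₁), lt_min hτ (by linarith : (0:ℝ) < 1 - ρ₁)]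
  -- the GNS constant and the uniform bound
  set K : ℝ≥0 := SNormLESNormFDerivOfEqConst E (volume : Measure E) 2 with hK
  set M : ℝ≥0∞ := C₃ ^ (2 / 3 : ℝ) * ((K : ℝ≥0∞) ^ 2 * (2 * (eLpNorm Gt 2 volume ^ 2 +
    ENNReal.ofReal (Cζ ^ 2) * eLpNorm ũ 2 volume ^ 2))) with hM
  have hMtop : M < ∞ := by
    rw [hM]
    refine ENNReal.mul_lt_top (ENNReal.rpow_lt_top_of_nonneg (by norm_num) hC₃.ne) ?_
    refine ENNReal.mul_lt_top (ENNReal.pow_lt_top ENNReal.coe_lt_top) ?_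
    refine ENNReal.mul_lt_top (by simp) (ENNReal.add_lt_top.2 ⟨?_, ?_⟩)
    · exact ENNReal.pow_lt_top hG2.eLpNorm_lt_top
    · exact ENNReal.mul_lt_top ENNReal.ofReal_lt_top (ENNReal.pow_lt_top hu2.eLpNorm_lt_top)
  -- ### the uniform bound for kernels of radius `< δ₀`
  have hbound : ∀ n, (φ n).rOut < δ₀ →
      ∫⁻ z in I ×ˢ ball (0 : E) ρ, ‖V n z.1 z.2‖ₑ ^ 4 ≤ M := by
    intro n hn
    -- (i)–(ii): interior points and the gradient of the mollification
    have hint : ∀ s ∈ I, ∀ y : E, ‖y‖ ≤ ρ₁ →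
        closedBall ((s, y) : ℝ × E) (φ n).rOut ⊆ (Qo : Set (ℝ × E)) := by
      intro s hs y hy
      rw [hQ]
      refine closedBall_subset_unitCylinder ?_ ?_ ?_
      · linarith [hs.1]
      · linarith [hs.2]
      · linarith
    have hDV : ∀ s ∈ I, ∀ y : E, ‖y‖ ≤ ρ₁ → fderiv ℝ (V n s) y = Gm n s y :=
      fun s hs y hy => hG.fderiv_mollified hu' hGi' (hkinf n) (hkr n) (hint s hs y hy)
    -- (iii): the cut-off slices
    set W : ℝ → E → E := fun s y => (ζ : E → ℝ) y • V n s y with hW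
    have hW1 : ∀ s, ContDiff ℝ 1 (W s) := fun s => hζ1.smul ((hVs n s).of_le one_le_infty)
    have hWc : ∀ s, HasCompactSupport (W s) := fun s => ζ.hasCompactSupport.smul_right
    have hWcont : Continuous (uncurry W) :=
      (ζ.continuous.comp continuous_snd).smul (hVc n)
    -- (v): the pointwise derivative bound
    have hDW : ∀ s ∈ I, ∀ y, ‖fderiv ℝ (W s) y‖ ≤ ‖Gm n s y‖ + Cζ * ‖V n s y‖ := by
      intro s hs y
      have hdζ : DifferentiableAt ℝ (ζ : E → ℝ) y := hζ1.differentiable one_ne_zero y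
      have hdV : DifferentiableAt ℝ (V n s) y := (hVs n s).differentiable (by simp) y
      rw [hW]
      change ‖fderiv ℝ (fun y => (ζ : E → ℝ) y • V n s y) y‖ ≤ _
      rw [fderiv_fun_smul hdζ hdV]
      rcases le_or_gt ‖y‖ ρ₁ with hy | hy
      · rw [hDV s hs y hy]
        refine (norm_add_le _ _).trans (add_le_add ?_ ?_)
        · rw [norm_smul]
          calc ‖(ζ : E → ℝ) y‖ * ‖Gm n s y‖ ≤ 1 * ‖Gm n s y‖ := by
                gcongr; rw [Real.norm_eq_abs, abs_of_nonneg (ζ.nonneg)]; exact ζ.le_one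
            _ = ‖Gm n s y‖ := one_mul _
        · exact (ContinuousLinearMap.norm_smulRight_apply _ _).le.trans
            (mul_le_mul_of_nonneg_right (hCζ y) (norm_nonneg _))
      · obtain ⟨h0, h0'⟩ := hζsupp y hy
        have hz : (0 : E →L[ℝ] ℝ).smulRight (V n s y) = 0 := by ext; simp
        rw [h0, h0', zero_smul, zero_add, hz, norm_zero]
        positivity
    -- (vi): the sliced `L²` bound for the derivative
    have mG : ∀ s, Measurable fun y => ‖Gm n s y‖ₑ ^ 2 := fun s =>
      ((hGmc n).comp (Continuous.prodMk_right s)).measurable.enorm.pow_const 2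
    have mV : ∀ s, Measurable fun y => ‖V n s y‖ₑ ^ 2 := fun s =>
      ((hVc n).comp (Continuous.prodMk_right s)).measurable.enorm.pow_const 2
    have hDW2 : ∀ s ∈ I, ∫⁻ y, ‖fderiv ℝ (W s) y‖ₑ ^ 2 ≤
        2 * ((∫⁻ y, ‖Gm n s y‖ₑ ^ 2) + ENNReal.ofReal (Cζ ^ 2) * ∫⁻ y, ‖V n s y‖ₑ ^ 2) := by
      intro s hs
      have e1 : ∀ y, ENNReal.ofReal (‖Gm n s y‖ ^ 2) = ‖Gm n s y‖ₑ ^ 2 := fun y => by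
        rw [← ofReal_norm, ENNReal.ofReal_pow (norm_nonneg _)]
      have e2 : ∀ y, ENNReal.ofReal (‖V n s y‖ ^ 2) = ‖V n s y‖ₑ ^ 2 := fun y => by
        rw [← ofReal_norm, ENNReal.ofReal_pow (norm_nonneg _)]
      calc ∫⁻ y, ‖fderiv ℝ (W s) y‖ₑ ^ 2
          ≤ ∫⁻ y, 2 * (‖Gm n s y‖ₑ ^ 2 + ENNReal.ofReal (Cζ ^ 2) * ‖V n s y‖ₑ ^ 2) := by
            refine lintegral_mono fun y => ?_
            have := enorm_sq_le_two_mul (hDW s hs y)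
            rwa [e1, e2] at this
        _ = 2 * ((∫⁻ y, ‖Gm n s y‖ₑ ^ 2) + ENNReal.ofReal (Cζ ^ 2) * ∫⁻ y, ‖V n s y‖ₑ ^ 2) := by
            have m12 : Measurable fun y => ‖Gm n s y‖ₑ ^ 2 + ENNReal.ofReal (Cζ ^ 2) * ‖V n s y‖ₑ ^ 2 :=
              (mG s).add ((mV s).const_mul _)
            rw [lintegral_const_mul _ m12, lintegral_add_left (mG s), lintegral_const_mul _ (mV s)]
    -- (vii): the sliced `L³` bound survives mollification
    have hV3 : ∀ s, ∫⁻ y, ‖W s y‖ₑ ^ (3 : ℝ) ≤ C₃ := by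
      intro s
      have h1 : ∀ y, ‖W s y‖ₑ ≤ ‖V n s y‖ₑ := fun y => by
        rw [hW]
        change ‖(ζ : E → ℝ) y • V n s y‖ₑ ≤ _
        rw [enorm_smul]
        calc ‖(ζ : E → ℝ) y‖ₑ * ‖V n s y‖ₑ ≤ 1 * ‖V n s y‖ₑ := by
              gcongr
              rw [← ofReal_norm, Real.norm_eq_abs, abs_of_nonneg ζ.nonneg]
              exact ENNReal.ofReal_le_one.2 ζ.le_one
          _ = ‖V n s y‖ₑ := one_mul _
      have h2 : ∀ y, V n s y = ((k n) ⋆[lsmul ℝ ℝ, volume] ũ') (s, y) := fun y => by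
        rw [hV]
        change stMollify (k n) ũ s y = _
        rw [stMollify_apply]
        exact convolution_lsmul_congr_ae hũũ' _
      calc ∫⁻ y, ‖W s y‖ₑ ^ (3 : ℝ) ≤ ∫⁻ y, ‖V n s y‖ₑ ^ (3 : ℝ) :=
            lintegral_mono fun y => ENNReal.rpow_le_rpow (h1 y) (by norm_num)
        _ = ∫⁻ y, ‖((k n) ⋆[lsmul ℝ ℝ, volume] ũ') (s, y)‖ₑ ^ (3 : ℝ) := by simp_rw [h2]
        _ ≤ C₃ := lintegral_rpow_slice_convolution_le (hk0 n) (φ n).continuous_normed (hkc n)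
            (hk1 n) hũ'm (by norm_num) h3' s
    -- (viii): interpolation and GNS, slice-wise
    have hslice : ∀ s ∈ I, ∫⁻ y, ‖W s y‖ₑ ^ 4 ≤ C₃ ^ (2 / 3 : ℝ) * ((K : ℝ≥0∞) ^ 2 *
        (2 * ((∫⁻ y, ‖Gm n s y‖ₑ ^ 2) + ENNReal.ofReal (Cζ ^ 2) * ∫⁻ y, ‖V n s y‖ₑ ^ 2))) := by
      intro s hs
      have hWm : AEStronglyMeasurable (W s) volume := (hW1 s).continuous.aestronglyMeasurable
      have hW2 : eLpNorm (W s) 2 volume < ∞ :=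
        ((hW1 s).continuous.memLp_of_hasCompactSupport (hWc s)).eLpNorm_lt_top
      have hGNS := eLpNorm_six_le_eLpNorm_fderiv_two (volume : Measure E) hE (hW1 s) hW2
      calc ∫⁻ y, ‖W s y‖ₑ ^ 4
          ≤ (∫⁻ y, ‖W s y‖ₑ ^ (3 : ℝ)) ^ (2 / 3 : ℝ) * (∫⁻ y, ‖W s y‖ₑ ^ (6 : ℝ)) ^ (1 / 3 : ℝ) :=
            lintegral_pow_four_le_interpolation volume hWm
        _ ≤ C₃ ^ (2 / 3 : ℝ) * (eLpNorm (W s) 6 volume) ^ 2 := by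
            rw [eLpNorm_six_pow_two]
            gcongr
            exact hV3 s
        _ ≤ C₃ ^ (2 / 3 : ℝ) * ((K : ℝ≥0∞) * eLpNorm (fderiv ℝ (W s)) 2 volume) ^ 2 := by
            gcongr
        _ = C₃ ^ (2 / 3 : ℝ) * ((K : ℝ≥0∞) ^ 2 * ∫⁻ y, ‖fderiv ℝ (W s) y‖ₑ ^ 2) := by
            rw [mul_pow, MollifiedLimits.eLpNorm_two_pow_two]
        _ ≤ C₃ ^ (2 / 3 : ℝ) * ((K : ℝ≥0∞) ^ 2 * (2 * ((∫⁻ y, ‖Gm n s y‖ₑ ^ 2) +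
              ENNReal.ofReal (Cζ ^ 2) * ∫⁻ y, ‖V n s y‖ₑ ^ 2))) := by
            gcongr
            exact hDW2 s hs
    -- (ix): integrate in time; Young's inequality for the space–time `L²` norms
    have mG2 : AEMeasurable (fun z : ℝ × E => ‖Gm n z.1 z.2‖ₑ ^ 2) (volume : Measure (ℝ × E)) :=
      (hGmc n).measurable.enorm.pow_const 2 |>.aemeasurable
    have mV2 : AEMeasurable (fun z : ℝ × E => ‖V n z.1 z.2‖ₑ ^ 2) (volume : Measure (ℝ × E)) :=
      (hVc n).measurable.enorm.pow_const 2 |>.aemeasurable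
    have mG2' : AEMeasurable (fun z : ℝ × E => ‖Gm n z.1 z.2‖ₑ ^ 2)
        ((volume : Measure ℝ).prod (volume : Measure E)) := by
      rw [← Measure.volume_eq_prod]; exact mG2
    have mV2' : AEMeasurable (fun z : ℝ × E => ‖V n z.1 z.2‖ₑ ^ 2)
        ((volume : Measure ℝ).prod (volume : Measure E)) := by
      rw [← Measure.volume_eq_prod]; exact mV2
    have hG_st : ∫⁻ s, ∫⁻ y, ‖Gm n s y‖ₑ ^ 2 ≤ eLpNorm Gt 2 volume ^ 2 := by
      have e : ∫⁻ z, ‖Gm n z.1 z.2‖ₑ ^ 2 ∂((volume : Measure ℝ).prod (volume : Measure E)) =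
          ∫⁻ s, ∫⁻ y, ‖Gm n s y‖ₑ ^ 2 := lintegral_prod (fun z : ℝ × E => ‖Gm n z.1 z.2‖ₑ ^ 2) mG2'
      rw [← e, ← Measure.volume_eq_prod, ← MollifiedLimits.eLpNorm_two_pow_two]
      change eLpNorm ((k n) ⋆[lsmul ℝ ℝ, volume] Gt) 2 volume ^ 2 ≤ _
      gcongr
      exact FunctionSpaces.eLpNorm_normed_convolution_le_haar (φ n) hG2.1 (by norm_num)
    have hV_st : ∫⁻ s, ∫⁻ y, ‖V n s y‖ₑ ^ 2 ≤ eLpNorm ũ 2 volume ^ 2 := by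
      have e : ∫⁻ z, ‖V n z.1 z.2‖ₑ ^ 2 ∂((volume : Measure ℝ).prod (volume : Measure E)) =
          ∫⁻ s, ∫⁻ y, ‖V n s y‖ₑ ^ 2 := lintegral_prod (fun z : ℝ × E => ‖V n z.1 z.2‖ₑ ^ 2) mV2'
      rw [← e, ← Measure.volume_eq_prod, ← MollifiedLimits.eLpNorm_two_pow_two]
      change eLpNorm ((k n) ⋆[lsmul ℝ ℝ, volume] ũ) 2 volume ^ 2 ≤ _
      gcongr
      exact FunctionSpaces.eLpNorm_normed_convolution_le_haar (φ n) hu2.1 (by norm_num)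
    have hint_t : ∫⁻ s in I, ∫⁻ y, ‖W s y‖ₑ ^ 4 ≤ M := by
      calc ∫⁻ s in I, ∫⁻ y, ‖W s y‖ₑ ^ 4
          ≤ ∫⁻ s in I, C₃ ^ (2 / 3 : ℝ) * ((K : ℝ≥0∞) ^ 2 * (2 * ((∫⁻ y, ‖Gm n s y‖ₑ ^ 2) +
              ENNReal.ofReal (Cζ ^ 2) * ∫⁻ y, ‖V n s y‖ₑ ^ 2))) :=
            setLIntegral_mono' measurableSet_Ioo fun s hs => hslice s hs
        _ ≤ ∫⁻ s, C₃ ^ (2 / 3 : ℝ) * ((K : ℝ≥0∞) ^ 2 * (2 * ((∫⁻ y, ‖Gm n s y‖ₑ ^ 2) +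
              ENNReal.ofReal (Cζ ^ 2) * ∫⁻ y, ‖V n s y‖ₑ ^ 2))) :=
            lintegral_mono' Measure.restrict_le_self le_rfl
        _ = C₃ ^ (2 / 3 : ℝ) * ((K : ℝ≥0∞) ^ 2 * (2 * ((∫⁻ s, ∫⁻ y, ‖Gm n s y‖ₑ ^ 2) +
              ENNReal.ofReal (Cζ ^ 2) * ∫⁻ s, ∫⁻ y, ‖V n s y‖ₑ ^ 2))) := by
            have m1 : AEMeasurable (fun s => ∫⁻ y, ‖Gm n s y‖ₑ ^ 2) (volume : Measure ℝ) :=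
              mG2'.lintegral_prod_right'
            have m2 : AEMeasurable (fun s => ∫⁻ y, ‖V n s y‖ₑ ^ 2) (volume : Measure ℝ) :=
              mV2'.lintegral_prod_right'
            have m12 : AEMeasurable (fun s => (∫⁻ y, ‖Gm n s y‖ₑ ^ 2) +
                ENNReal.ofReal (Cζ ^ 2) * ∫⁻ y, ‖V n s y‖ₑ ^ 2) (volume : Measure ℝ) :=
              m1.add (m2.const_mul _)
            have m3 : AEMeasurable (fun s => 2 * ((∫⁻ y, ‖Gm n s y‖ₑ ^ 2) +
                ENNReal.ofReal (Cζ ^ 2) * ∫⁻ y, ‖V n s y‖ₑ ^ 2)) (volume : Measure ℝ) :=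
              m12.const_mul _
            have m4 : AEMeasurable (fun s => (K : ℝ≥0∞) ^ 2 * (2 * ((∫⁻ y, ‖Gm n s y‖ₑ ^ 2) +
                ENNReal.ofReal (Cζ ^ 2) * ∫⁻ y, ‖V n s y‖ₑ ^ 2))) (volume : Measure ℝ) :=
              m3.const_mul _
            rw [lintegral_const_mul'' _ m4, lintegral_const_mul'' _ m3, lintegral_const_mul'' _ m12,
              lintegral_add_left' m1, lintegral_const_mul'' _ m2]
        _ ≤ M := by
            rw [hM]
            gcongr
    -- (x): on `I × B(0, ρ)` the cut-off is `1`
    calc ∫⁻ z in I ×ˢ ball (0 : E) ρ, ‖V n z.1 z.2‖ₑ ^ 4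
        = ∫⁻ z in I ×ˢ ball (0 : E) ρ, ‖W z.1 z.2‖ₑ ^ 4 := by
          refine setLIntegral_congr_fun (measurableSet_Ioo.prod measurableSet_ball) fun z hz => ?_
          have hz1 : (ζ : E → ℝ) z.2 = 1 :=
            ζ.one_of_mem_closedBall (ball_subset_closedBall hz.2)
          simp only [hW, hz1, one_smul]
      _ ≤ ∫⁻ z in I ×ˢ (univ : Set E), ‖W z.1 z.2‖ₑ ^ 4 :=
          lintegral_mono_set (prod_mono Subset.rfl (subset_univ _))
      _ = ∫⁻ s in I, ∫⁻ y, ‖W s y‖ₑ ^ 4 := by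
          have hWm' : AEMeasurable (fun z : ℝ × E => ‖W z.1 z.2‖ₑ ^ 4)
              (((volume : Measure ℝ).restrict I).prod (volume : Measure E)) :=
            (show Measurable (fun z : ℝ × E => ‖W z.1 z.2‖ₑ ^ 4) from
              hWcont.measurable.enorm.pow_const 4).aemeasurable
          rw [Measure.volume_eq_prod, ← Measure.restrict_prod_eq_prod_univ]
          exact lintegral_prod (fun z : ℝ × E => ‖W z.1 z.2‖ₑ ^ 4) hWm'
      _ ≤ M := hint_t
  -- ### Fatou along an a.e.-convergent subsequence
  have hconv : Tendsto (fun n => eLpNorm ((fun z : ℝ × E => V n z.1 z.2) - ũ) 2 volume) atTop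
      (𝓝 0) := by
    have := FunctionSpaces.tendsto_eLpNorm_normed_convolution_sub_self (μ := (volume : Measure (ℝ × E))) hφr
      (p := 2) (by norm_num) (by norm_num) hu2
    exact this
  have hVm : ∀ n, AEStronglyMeasurable (fun z : ℝ × E => V n z.1 z.2) volume := fun n =>
    (hVc n).aestronglyMeasurable
  obtain ⟨ns, hns, hae⟩ :=
    (tendstoInMeasure_of_tendsto_eLpNorm two_ne_zero hVm hu2.1 hconv).exists_seq_tendsto_ae
  have hev : ∀ᶠ j in atTop, (φ (ns j)).rOut < δ₀ :=
    hns.tendsto_atTop.eventually ((tendsto_order.1 hφr).2 δ₀ hδ₀pos)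
  have hlim : ∀ᵐ z : ℝ × E, liminf (fun j => ‖V (ns j) z.1 z.2‖ₑ ^ 4) atTop = ‖ũ z‖ₑ ^ 4 := by
    filter_upwards [hae] with z hz
    refine Tendsto.liminf_eq ?_
    exact ((ENNReal.continuous_pow 4).tendsto _).comp ((continuous_enorm.tendsto _).comp hz)
  calc ∫⁻ z in I ×ˢ ball (0 : E) ρ, ‖ũ z‖ₑ ^ 4
      = ∫⁻ z in I ×ˢ ball (0 : E) ρ, liminf (fun j => ‖V (ns j) z.1 z.2‖ₑ ^ 4) atTop :=
        lintegral_congr_ae ((ae_restrict_of_ae hlim).mono fun z hz => hz.symm)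
    _ ≤ liminf (fun j => ∫⁻ z in I ×ˢ ball (0 : E) ρ, ‖V (ns j) z.1 z.2‖ₑ ^ 4) atTop :=
        lintegral_liminf_le' fun j => ((hVm (ns j)).enorm.pow_const 4).restrict
    _ ≤ M := liminf_le_of_frequently_le' (hev.mono fun j hj => hbound (ns j) hj).frequently
    _ < ∞ := hMtop

end L4

end Literature.Analysis.FluidPDE
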